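import Mathlib
import Literature.RingTheory.HopfAlgebra.FiniteDualHopfAlgebra
import Literature.AlgebraicGeometry.Motives.TannakianDistributionsAntipode
import HarnessLib

/-!
# The bidual of a finite free bialgebra: `B ≃ B^**` as bialgebras (hence as Hopf algebras)
(Tate, *Finite flat group schemes* (in Cornell–Silverman–Stevens 1997), §(3.8) «The dual Hopf algebra and Cartier duality»,
p. 145: «the canonical map `A → A″` is an isomorphism of Hopf algebras, so `G ≃ (G^D)^D`»; Montgomery, *Hopf algebras and their
actions on rings*, CBMS 82 (1993), 9.1.3)

Topic `RingTheory/HopfAlgebra`; namespace `Literature.RingTheory.HopfAlgebra`.  THEOREMS ONLY (no definition, no instance, no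
notation, no named fact, no `sorry`).  Cell `pub/hodgecm-mathlib` (D-0151), FLOOR 0, programme F0P5a (crux item
stmt-HodgeConjecture-24832; PLAN v4.1 ∕ MOD-ROAD-P″ add2 KF8 «duality row», H-CD piece CD2-bidual); road- and floor-independent
commutative algebra; changes no count.

SETTING.  `R` a commutative semiring, `B` an `R`-bialgebra, finite and free as an `R`-module; `W := WithConv (Module.Dual R B)` its
dual, carrying Mathlib's convolution algebra and the dual coalgebra ∕ bialgebra of ★ `FiniteDualHopfAlgebra` (the reducible
definitions `FiniteDual.coalgebra R B`, `FiniteDual.bialgebra R B`, installed with `letI` — here INSIDE the statements, as in that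
file's `FiniteDual.isCocomm`); `W` is again finite free (Mathlib `Module.dual_free ∕ dual_finite` through `WithConv.linearEquiv`), so
`W^* := WithConv (Module.Dual R W)` carries `FiniteDual.bialgebra R W`.  The BIDUAL MAP is any `R`-linear
`β : B → W^*` with `(β x) f = f x` (it exists and is unique, §1; DEF-FREE: every statement takes `β` and this characterisation
`hβ` as hypotheses).

* §1 `exists_bidualMap`, `bidualMap_unique`, **`bidualMap_bijective`** (finite free: `β` is Mathlib's `Module.evalEquiv` read
  through `WithConv.linearEquiv` twice).
* §2 `β` is an ALGEBRA map into the convolution algebra of the dual coalgebra: `mul'_map_bidualMap_eq_evalTwo`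
  (`Σ (β x)(gᵢ)(β y)(hᵢ) = evalTwo (Σ gᵢ ⊗ hᵢ) (x ⊗ y)`), **`bidualMap_mul`** (`β (x y) = β x * β y`, by
  `FiniteDual.evalTwo_comul : evalTwo (Δ_W f) (x ⊗ y) = f (x y)`), **`bidualMap_one`**.
* §3 `β` is a COALGEBRA map: **`counit_bidualMap`** (`ε_{W^*} (β x) = ε_B x`), `evalTwo_map_bidualMap_comul`,
  `evalTwo_comul_bidualMap`, **`map_bidualMap_comp_comul`** (`(β ⊗ β) ∘ Δ_B = Δ_{W^*} ∘ β`, through ★ CD1-thm's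
  `eq_of_evalTwo_eq` at `W`).
* §4 HEAD **`exists_bialgEquiv_bidual`**: `∃ e : B ≃ₐc[R] W^*, ∀ x f, (e x) f = f x` — `B ≃ B^**` as bialgebras; and for a Hopf
  algebra `B`, **`bidualMap_antipode`**: `β (S x) = S^{**} (β x)` for the antipode `Tannakian.dualAntipode` of
  `FiniteDual.hopfAlgebra` (so the isomorphism is one of Hopf algebras; Mathlib has no separate Hopf-morphism type).

NOT here: points (★ `FiniteDualPoints`), base change (★ `FiniteDualBaseChange`), quotients ∕ subalgebras (★ `FiniteDualQuotient`,
`FiniteDualSubalgebra`), group schemes.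

HC_CM is proved only modulo the 7 printed citations until rung 0 closes; this file is generic algebra and changes no count.

## References
* [Tate1997FiniteFlatGroupSchemes] J. Tate, *Finite flat group schemes*, in: Modular Forms and Fermat's Last Theorem (1997), §(3.8)
  p. 145 (`A ≃ A″`, `G ≃ (G^D)^D`).
* [Montgomery1993Hopf] S. Montgomery, *Hopf algebras and their actions on rings*, CBMS 82 (1993), 9.1.3.
-/

set_option autoImplicit false

noncomputable section

open TensorProduct WithConv

namespace Literature.RingTheory.HopfAlgebra

universe u v

variable {R : Type u} [CommSemiring R] {B : Type v}

/-! ## §1 The bidual map `x ↦ (f ↦ f x)` -/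

section Linear

variable [AddCommMonoid B] [Module R B]

variable (R B) in
/-- **existence of the bidual map** `β : B → (B^*)^*`, `(β x) f = f x`. [cite: Tate1997FiniteFlatGroupSchemes, §(3.8) p. 145] -/
theorem exists_bidualMap :
    ∃ β : B →ₗ[R] WithConv (Module.Dual R (WithConv (Module.Dual R B))),
      ∀ (x : B) (f : WithConv (Module.Dual R B)), (β x) f = f x :=
  ⟨(WithConv.linearEquiv R (Module.Dual R (WithConv (Module.Dual R B)))).symm.toLinearMap ∘ₗ
      (Module.Dual.congr (WithConv.linearEquiv R (Module.Dual R B)).symm).toLinearMap ∘ₗ Module.Dual.eval R B,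
    fun _ _ => rfl⟩

variable {β β' : B →ₗ[R] WithConv (Module.Dual R (WithConv (Module.Dual R B)))}

/-- the bidual map is unique. [cite: Tate1997FiniteFlatGroupSchemes, §(3.8) p. 145] -/
theorem bidualMap_unique (hβ : ∀ (x : B) (f : WithConv (Module.Dual R B)), (β x) f = f x)
    (hβ' : ∀ (x : B) (f : WithConv (Module.Dual R B)), (β' x) f = f x) : β = β' :=
  LinearMap.ext fun x => WithConv.ext (LinearMap.ext fun f => by
    change (β x) f = (β' x) f
    rw [hβ, hβ'])

/-- **the bidual map is bijective for `B` finite free** (Mathlib's `Module.evalEquiv`: finite free modules are reflexive).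
[cite: Tate1997FiniteFlatGroupSchemes, §(3.8) p. 145] -/
theorem bidualMap_bijective [Module.Free R B] [Module.Finite R B]
    (hβ : ∀ (x : B) (f : WithConv (Module.Dual R B)), (β x) f = f x) : Function.Bijective β := by
  let E : B ≃ₗ[R] WithConv (Module.Dual R (WithConv (Module.Dual R B))) :=
    Module.evalEquiv R B ≪≫ₗ Module.Dual.congr (WithConv.linearEquiv R (Module.Dual R B)).symm ≪≫ₗ
      (WithConv.linearEquiv R (Module.Dual R (WithConv (Module.Dual R B)))).symm
  have hE : β = E.toLinearMap := bidualMap_unique hβ fun x f => rfl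
  rw [hE]
  exact E.bijective

end Linear

/-! ## §2 `β` is multiplicative and unital into the convolution algebra of the dual coalgebra `W` -/

section Algebra

variable [Semiring B] [Algebra R B]
variable {β : B →ₗ[R] WithConv (Module.Dual R (WithConv (Module.Dual R B)))}

/-- `Σ (β x)(gᵢ) (β y)(hᵢ) = evalTwo (Σ gᵢ ⊗ hᵢ) (x ⊗ y)`: the contraction against `β x ⊗ β y` of an element of `W ⊗ W` is
its evaluation pairing at `x ⊗ y`. [cite: Tate1997FiniteFlatGroupSchemes, §(3.8) p. 145] -/
theorem mul'_map_bidualMap_eq_evalTwo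
    (hβ : ∀ (x : B) (f : WithConv (Module.Dual R B)), (β x) f = f x) (x y : B)
    (t : WithConv (Module.Dual R B) ⊗[R] WithConv (Module.Dual R B)) :
    LinearMap.mul' R R (TensorProduct.map (β x).ofConv (β y).ofConv t) = FiniteDual.evalTwo R B t (x ⊗ₜ y) := by
  induction t using TensorProduct.induction_on with
  | zero => simp
  | add s t hs ht => rw [map_add, map_add, hs, ht, map_add, LinearMap.add_apply]
  | tmul g h =>
    rw [TensorProduct.map_tmul, LinearMap.mul'_apply, FiniteDual.evalTwo_tmul]
    exact congrArg₂ (· * ·) (hβ x g) (hβ y h)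

/-- **`β (x y) = β x * β y`** in the convolution algebra `W^*` of the dual coalgebra `W = B^*` (`Δ_W = μ^*`):
`(β x * β y) f = evalTwo (Δ_W f) (x ⊗ y) = f (x y)`. [cite: Tate1997FiniteFlatGroupSchemes, §(3.8) p. 145] -/
theorem bidualMap_mul [Module.Free R B] [Module.Finite R B] (hβ : ∀ (x : B) (f : WithConv (Module.Dual R B)), (β x) f = f x) (x y : B) :
    letI : Coalgebra R (WithConv (Module.Dual R B)) := FiniteDual.coalgebra R B
    β (x * y) = β x * β y := by
  letI : Coalgebra R (WithConv (Module.Dual R B)) := FiniteDual.coalgebra R B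
  refine WithConv.ext (LinearMap.ext fun f => ?_)
  change (β (x * y)) f = (β x * β y) f
  rw [hβ, LinearMap.convMul_apply, mul'_map_bidualMap_eq_evalTwo hβ]
  exact (FiniteDual.evalTwo_comul f x y).symm

/-- **`β 1 = 1`**: the unit of `W^*` is `ε_W = (f ↦ f 1)`. [cite: Tate1997FiniteFlatGroupSchemes, §(3.8) p. 145] -/
theorem bidualMap_one [Module.Free R B] [Module.Finite R B] (hβ : ∀ (x : B) (f : WithConv (Module.Dual R B)), (β x) f = f x) :
    letI : Coalgebra R (WithConv (Module.Dual R B)) := FiniteDual.coalgebra R B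
    β 1 = 1 := by
  letI : Coalgebra R (WithConv (Module.Dual R B)) := FiniteDual.coalgebra R B
  refine WithConv.ext (LinearMap.ext fun f => ?_)
  change (β 1) f = (1 : WithConv (Module.Dual R (WithConv (Module.Dual R B)))) f
  rw [hβ, LinearMap.convOne_def]
  change f 1 = algebraMap R R (FiniteDual.counit R B f)
  rw [FiniteDual.counit_apply, Algebra.algebraMap_self, RingHom.id_apply]

end Algebra

/-! ## §3 `β` is a coalgebra map `B → W^*` for the dual coalgebra of `W = B^*` -/

section Coalgebra

variable [Semiring B] [Bialgebra R B]
variable {β : B →ₗ[R] WithConv (Module.Dual R (WithConv (Module.Dual R B)))}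

/-- the unit of the convolution algebra `W = B^*` evaluates as the counit: `(1 : W) x = ε x`.
[cite: Montgomery1993Hopf, 9.1.3] -/
theorem convOne_apply_eq_counit (x : B) : (1 : WithConv (Module.Dual R B)) x = Coalgebra.counit x := by
  rw [LinearMap.convOne_def]
  rfl

/-- **`ε_{W^*} (β x) = ε_B x`**: the counit of the bidual is evaluation at `1_W = ε_B`.
[cite: Tate1997FiniteFlatGroupSchemes, §(3.8) p. 145] -/
theorem counit_bidualMap [Module.Free R B] [Module.Finite R B] (hβ : ∀ (x : B) (f : WithConv (Module.Dual R B)), (β x) f = f x) (x : B) :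
    letI : Bialgebra R (WithConv (Module.Dual R B)) := FiniteDual.bialgebra R B
    FiniteDual.counit R (WithConv (Module.Dual R B)) (β x) = Coalgebra.counit x := by
  rw [FiniteDual.counit_apply, hβ, convOne_apply_eq_counit]

/-- `evalTwo_W ((β ⊗ β)(Δ x)) (f ⊗ f') = (f * f') x`: pairing `(β ⊗ β)(Δ_B x)` with `f ⊗ f'` gives the convolution product
evaluated at `x`. [cite: Tate1997FiniteFlatGroupSchemes, §(3.8) p. 145] -/
theorem evalTwo_map_bidualMap_comul (hβ : ∀ (x : B) (f : WithConv (Module.Dual R B)), (β x) f = f x) (x : B)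
    (f f' : WithConv (Module.Dual R B)) :
    FiniteDual.evalTwo R (WithConv (Module.Dual R B)) (TensorProduct.map β β (Coalgebra.comul x)) (f ⊗ₜ f') =
      (f * f') x := by
  let 𝓡 := Coalgebra.Repr.arbitrary R x
  rw [𝓡.convMul_apply, ← 𝓡.eq, map_sum, map_sum, LinearMap.sum_apply]
  refine Finset.sum_congr rfl fun i _ => ?_
  rw [TensorProduct.map_tmul, FiniteDual.evalTwo_tmul, hβ, hβ]

/-- `evalTwo_W (Δ_{W^*} (β x)) (f ⊗ f') = (f * f') x` (`Δ_{W^*}` = the transpose of the convolution product of `W`).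
[cite: Tate1997FiniteFlatGroupSchemes, §(3.8) p. 145] -/
theorem evalTwo_comul_bidualMap [Module.Free R B] [Module.Finite R B] (hβ : ∀ (x : B) (f : WithConv (Module.Dual R B)), (β x) f = f x) (x : B)
    (f f' : WithConv (Module.Dual R B)) :
    letI : Bialgebra R (WithConv (Module.Dual R B)) := FiniteDual.bialgebra R B
    haveI : Module.Free R (WithConv (Module.Dual R B)) := Module.Free.of_equiv (WithConv.linearEquiv R (Module.Dual R B)).symm
    haveI : Module.Finite R (WithConv (Module.Dual R B)) := Module.Finite.equiv (WithConv.linearEquiv R (Module.Dual R B)).symm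
    FiniteDual.evalTwo R (WithConv (Module.Dual R B))
        (FiniteDual.comul R (WithConv (Module.Dual R B)) (β x)) (f ⊗ₜ f') = (f * f') x := by
  letI : Bialgebra R (WithConv (Module.Dual R B)) := FiniteDual.bialgebra R B
  haveI : Module.Free R (WithConv (Module.Dual R B)) := Module.Free.of_equiv (WithConv.linearEquiv R (Module.Dual R B)).symm
  haveI : Module.Finite R (WithConv (Module.Dual R B)) := Module.Finite.equiv (WithConv.linearEquiv R (Module.Dual R B)).symm
  rw [FiniteDual.evalTwo_comul, hβ]

/-- **`(β ⊗ β) ∘ Δ_B = Δ_{W^*} ∘ β`**: the bidual map is compatible with the comultiplications (both sides pair with `f ⊗ f'`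
to `(f * f') x`, and `evalTwo_W` is injective on `W^* ⊗ W^*` — ★ CD1-thm `eq_of_evalTwo_eq` at `W`).
[cite: Tate1997FiniteFlatGroupSchemes, §(3.8) p. 145] -/
theorem map_bidualMap_comp_comul [Module.Free R B] [Module.Finite R B] (hβ : ∀ (x : B) (f : WithConv (Module.Dual R B)), (β x) f = f x) :
    letI : Bialgebra R (WithConv (Module.Dual R B)) := FiniteDual.bialgebra R B
    haveI : Module.Free R (WithConv (Module.Dual R B)) := Module.Free.of_equiv (WithConv.linearEquiv R (Module.Dual R B)).symm
    haveI : Module.Finite R (WithConv (Module.Dual R B)) := Module.Finite.equiv (WithConv.linearEquiv R (Module.Dual R B)).symm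
    TensorProduct.map β β ∘ₗ Coalgebra.comul (R := R) (A := B) =
      FiniteDual.comul R (WithConv (Module.Dual R B)) ∘ₗ β := by
  letI : Bialgebra R (WithConv (Module.Dual R B)) := FiniteDual.bialgebra R B
  haveI : Module.Free R (WithConv (Module.Dual R B)) := Module.Free.of_equiv (WithConv.linearEquiv R (Module.Dual R B)).symm
  haveI : Module.Finite R (WithConv (Module.Dual R B)) := Module.Finite.equiv (WithConv.linearEquiv R (Module.Dual R B)).symm
  refine LinearMap.ext fun x => ?_
  refine eq_of_evalTwo_eq (ev := FiniteDual.evalTwo R (WithConv (Module.Dual R B))) FiniteDual.evalTwo_tmul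
    fun f f' => ?_
  rw [LinearMap.comp_apply, LinearMap.comp_apply, evalTwo_map_bidualMap_comul hβ,
    evalTwo_comul_bidualMap hβ]

end Coalgebra

/-! ## §4 `B ≃ B^**` as bialgebras; the antipodes -/

section Bidual

variable [Semiring B]

/-- **`B ≃ B^**` AS BIALGEBRAS** (Tate: «the canonical map `A → A″` is an isomorphism … `G ≃ (G^D)^D`»): for a bialgebra `B`
finite free over `R`, with the dual bialgebra structures of ★ `FiniteDualHopfAlgebra` on `W = B^*` and on `W^*`, there is a
bialgebra isomorphism `e : B ≃ₐc[R] W^*` with `(e x) f = f x`.  Stated as an existence so that no definition is introduced; `e`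
is the bidual map, pinned pointwise. [cite: Tate1997FiniteFlatGroupSchemes, §(3.8) p. 145] -/
theorem exists_bialgEquiv_bidual [Bialgebra R B] [Module.Free R B] [Module.Finite R B] :
    letI : Bialgebra R (WithConv (Module.Dual R B)) := FiniteDual.bialgebra R B
    haveI : Module.Free R (WithConv (Module.Dual R B)) := Module.Free.of_equiv (WithConv.linearEquiv R (Module.Dual R B)).symm
    haveI : Module.Finite R (WithConv (Module.Dual R B)) := Module.Finite.equiv (WithConv.linearEquiv R (Module.Dual R B)).symm
    letI : Bialgebra R (WithConv (Module.Dual R (WithConv (Module.Dual R B)))) :=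
      FiniteDual.bialgebra R (WithConv (Module.Dual R B))
    ∃ e : B ≃ₐc[R] WithConv (Module.Dual R (WithConv (Module.Dual R B))),
      ∀ (x : B) (f : WithConv (Module.Dual R B)), (e x) f = f x := by
  letI : Bialgebra R (WithConv (Module.Dual R B)) := FiniteDual.bialgebra R B
  haveI : Module.Free R (WithConv (Module.Dual R B)) := Module.Free.of_equiv (WithConv.linearEquiv R (Module.Dual R B)).symm
  haveI : Module.Finite R (WithConv (Module.Dual R B)) := Module.Finite.equiv (WithConv.linearEquiv R (Module.Dual R B)).symm
  letI : Bialgebra R (WithConv (Module.Dual R (WithConv (Module.Dual R B)))) :=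
    FiniteDual.bialgebra R (WithConv (Module.Dual R B))
  obtain ⟨β, hβ⟩ := exists_bidualMap R B
  have hbij := bidualMap_bijective hβ
  refine ⟨{ toFun := β,
             map_add' := β.map_add,
             map_smul' := β.map_smul,
             counit_comp := LinearMap.ext fun x => counit_bidualMap hβ x,
             map_comp_comul := map_bidualMap_comp_comul hβ,
             invFun := (Equiv.ofBijective β hbij).symm,
             left_inv := (Equiv.ofBijective β hbij).left_inv,
             right_inv := (Equiv.ofBijective β hbij).right_inv,
             map_mul' := fun x y => bidualMap_mul hβ x y }, fun x f => hβ x f⟩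

/-- **the bidual map commutes with the antipodes**: for a Hopf algebra `B`, `β (S x) = S^{**} (β x)`, where the antipode of
`W^*` is `Tannakian.dualAntipode` for the dual Hopf algebra `FiniteDual.hopfAlgebra R B` on `W` (`(S^* f) = f ∘ S`) — so the
bialgebra isomorphism `B ≃ B^**` is one of Hopf algebras. [cite: Montgomery1993Hopf, 9.1.3] -/
theorem bidualMap_antipode [HopfAlgebra R B] [Module.Free R B] [Module.Finite R B]
    {β : B →ₗ[R] WithConv (Module.Dual R (WithConv (Module.Dual R B)))}
    (hβ : ∀ (x : B) (f : WithConv (Module.Dual R B)), (β x) f = f x) (x : B) :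
    letI : HopfAlgebra R (WithConv (Module.Dual R B)) := FiniteDual.hopfAlgebra R B
    β (HopfAlgebra.antipode R x) =
      Literature.AlgebraicGeometry.Motives.Tannakian.dualAntipode (R := R) (A := WithConv (Module.Dual R B)) (β x) := by
  letI : HopfAlgebra R (WithConv (Module.Dual R B)) := FiniteDual.hopfAlgebra R B
  refine WithConv.ext (LinearMap.ext fun f => ?_)
  change (β (HopfAlgebra.antipode R x)) f =
    Literature.AlgebraicGeometry.Motives.Tannakian.dualAntipode (R := R) (A := WithConv (Module.Dual R B)) (β x) f
  rw [Literature.AlgebraicGeometry.Motives.Tannakian.dualAntipode_apply_apply, hβ, hβ]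
  rfl

end Bidual

end Literature.RingTheory.HopfAlgebra
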